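/-
Copyright: the b2b-balaban T⁴-continuum CRUX team, row NE7b, leaf prover `t4-ne7b-formalise-leaf-01` (gen 79), for the
OWNER lineage `t4-ne7b-p1` (gen 105's memo `A1C-LCS-RESIDUAL-g105.md` §2, residual (R2)) and the refuter desk. Project licence.
-/
import Literature.Analysis.Convexity.PrekopaLeindler
import Mathlib.Probability.Distributions.Gaussian.Real
import Mathlib.MeasureTheory.Integral.Pi

/-!
# ANDERSON's COMPARISON FOR CENTRED GAUSSIANS, FUNCTIONAL FORM: a WIDER centred Gaussian gives LESS weight to an EVEN
# LOG-CONCAVE function — the kernel mechanism behind «the even convex part of the non-Gaussian small-field remainder, and every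
# symmetric convex small-field restriction, cost NOTHING in LCS-j» (row NE7b, node U5c; model theorem of real analysis)

Cell `pub-balaban`, sub-cell `t4`, spine estimate NE7b (`T4WeightBudget.RelWeightBound` — the cell's OWN estimate, NOT PRINTED in
[Bałaban 1983–89], NOT PROVED).  Crux-route MODEL work under `Spine/NE7b/`: finite-dimensional real analysis over Mathlib and the tree's
Prékopa–Leindler inequality; it types NO `T4Continuum/Support` leaf, mints no `Prop`, names no object of [B15]∕[B16]; 0 `sorry`.

WHY.  After the OWNER's Gaussian share of «LCS-j» (`GaussianDominatedMoment` … `GaussianTranslatedMass`, gen 105) the (A1c) residual of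
Bałaban's KIND at a pinned step is (R1″) + **(R2) = the NON-GAUSSIAN small-field remainder**: the one-step density is `χ·e^{−S−V}`, not
`e^{−S}`, and the carrier ratio `∫ e^{Q} χ e^{−S−V} ∕ ∫ χ e^{−S−V}` must still be `≤ e^{O(1)·#Z}` (memo `A1C-LCS-RESIDUAL-g105.md` §2:
«NO kernel object today»).  THIS FILE supplies the comparison mechanism for the part of that problem which is FREE: whenever the
non-Gaussian factor `F = χ·e^{−V}` is EVEN and LOG-CONCAVE (every indicator of a symmetric convex small-field domain
`{z : zᵀQ_b z ≤ θ_b ∀ b}`; `e^{−V}` for `V` convex and even; products of such), replacing the Gaussian weight `e^{−|y|²}` by ANY WIDER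
centred Gaussian `e^{−Σ aᵢyᵢ²}`, `0 < aᵢ ≤ 1`, can only DECREASE the normalised `F`-average:
  `(∫ F·e^{−Σaᵢyᵢ²})·(∫ e^{−|y|²}) ≤ (∫ F·e^{−|y|²})·(∫ e^{−Σaᵢyᵢ²})`   (`lintegral_mul_wide_le`, §4).
Since `e^{yᵀQy}e^{−yᵀSy}` IS a wider Gaussian, the companion `LogConcaveDominatedMoment` turns this into
`∫ F e^{Q} e^{−S} ≤ (√(1−δ))⁻¹ ^ r · ∫ F e^{−S}` — the OWNER's constant, with NO `(1−η)⁻¹` device and NO decoupling error.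
This is T. W. Anderson's 1955 theorem (PAMS 6, 170–176: the integral of a symmetric unimodal function over a symmetric convex set; its
Gaussian corollary «`Σ ≤ Σ'` ⇒ `E_{Σ'} f ≤ E_Σ f`») in the functional form needed here; the tree holds the SET form for product Gaussians
(`Literature.Probability.Distributions.KhatriSidak.anderson_piGaussian`, via Giné–Nickl Thm 2.4.4), not this one.

WHAT IS PROVED ([folklore]; ingredients: the tree's `prekopaLeindler_pi`, Mathlib's `gaussianReal`, `integral_gaussian`, Tonelli):
* §1 `prekopaLeindler_fintype` — Prékopa–Leindler on `ι → ℝ` for a general finite index type (transport of the tree's `Fin n` form).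
* §2 **`lintegral_shift_mul_le`** — FUNCTIONAL ANDERSON: for `F, ρ ≥ 0` measurable, even and midpoint-log-concave
  (`F x · F y ≤ F((x+y)∕2)²`), every translate loses weight: `∫ F(z + w) ρ(z) dz ≤ ∫ F ρ` (Prékopa–Leindler at `s = ½` + evenness).
* §3 `integral_exp_neg_sq_sub_gaussianReal`, `integral_exp_neg_sum_sq_sub_pi`, `lintegral_exp_neg_sum_sq_sub_pi` — the GAUSSIAN MIXTURE
  IDENTITY: `√a·e^{−a t²} = ∫ e^{−(t−w)²} dN(0, (1−a)∕(2a))(w)` for `0 < a ≤ 1` (a Dirac mass when `a = 1` — Mathlib's `gaussianReal`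
  with variance `0`), and its product over the coordinates: a wider centred Gaussian is a Gaussian average of translates of the narrow one.
* §4 `lintegral_mixture_eq` (Tonelli + translation invariance: `(Π√aᵢ)·∫ G e^{−Σaᵢyᵢ²} = ∫ (∫ G(z+w) e^{−|z|²} dz) dν(w)`),
  `gaussWeight_evenLogConcave`, and the comparison **`lintegral_mul_wide_le`** displayed above (§2 inside §4's mixture).

NOT HERE (honest).  Nothing of Bałaban's: the cubic ∕ background-dependent (odd, non-convex) part of print's `V` ([B15] (0.3)–(0.5)) is
exactly what this mechanism does NOT cover — there the cluster ∕ random-walk expansion of print is needed and (R2) proper is UNMOVED;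
no identification (A3).  The comparison is CENTRED (both Gaussians and `F` even about `0`): over a far field the (A1c) near fibre is
SHIFTED, and the zero-cost statement holds modulo (R1″) (refuter κ-ne7bref-g67-4 (a)); §2's shift form bounds numerators only.  BY-NAME EFFECT ON THE WALL: NONE.  NE7b NOT PRINTED ∕ NOT PROVED; spine PROVED 0∕9; rung (B)+1 on a FINITE
torus — NOT infinite volume, NOT the mass gap, NOT Clay.
HONEST DEPENDENCY: continuum YM on T⁴ ⇐ BetaPertH ∧ nine spine estimates (0/9 proved); BetaPertH ⇐ (D1) ∧ (D4) ∧ CAP+tail;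
G-an2-4 gates asym, D1 and NE2/3/4.
-/

set_option autoImplicit false

open MeasureTheory ProbabilityTheory Real Finset
open scoped ENNReal NNReal

namespace Summit.QuantumFields.BalabanUV.T4Continuum.NE7b.AndersonGaussianComparison

/-! ## §1 Prékopa–Leindler on `ι → ℝ` for a general finite index type -/

section PL

variable {ι : Type*} [Fintype ι]

/-- **Prékopa–Leindler on `ι → ℝ`** (Lebesgue measure, `ℝ≥0∞`-valued form) for an arbitrary finite index type: if `f, g, h ≥ 0` are
measurable, `0 < s < 1` and `h((1−s)x + sy) ≥ f(x)^{1−s} g(y)^s`, then `∫ h ≥ (∫ f)^{1−s}(∫ g)^s` — the tree's `prekopaLeindler_pi`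
(on `Fin n → ℝ`) transported along the volume-preserving reindexing `ι ≃ Fin |ι|`. [cite: BrascampLieb1976, Thm 3.3] -/
theorem prekopaLeindler_fintype {s : ℝ} (hs0 : 0 < s) (hs1 : s < 1) {f g h : (ι → ℝ) → ℝ≥0∞} (hf : Measurable f)
    (hg : Measurable g) (hh : Measurable h) (H : ∀ x y, f x ^ (1 - s) * g y ^ s ≤ h ((1 - s) • x + s • y)) :
    (∫⁻ x, f x) ^ (1 - s) * (∫⁻ y, g y) ^ s ≤ ∫⁻ z, h z := by
  classical
  set e := MeasurableEquiv.piCongrLeft (fun _ : Fin (Fintype.card ι) => ℝ) (Fintype.equivFin ι) with he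
  have hmp : MeasurePreserving e.symm volume volume :=
    (volume_measurePreserving_piCongrLeft (fun _ : Fin (Fintype.card ι) => ℝ) (Fintype.equivFin ι)).symm
  have hlin : ∀ (a b : ℝ) (x y : Fin (Fintype.card ι) → ℝ), e.symm (a • x + b • y) = a • e.symm x + b • e.symm y := by
    intro a b x y
    ext i
    rfl
  rw [← hmp.lintegral_comp hf, ← hmp.lintegral_comp hg, ← hmp.lintegral_comp hh]
  refine Literature.Analysis.Convexity.prekopaLeindler_pi hs0 hs1 (Fintype.card ι) (hf.comp e.symm.measurable)
    (hg.comp e.symm.measurable) (hh.comp e.symm.measurable) fun x y => ?_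
  simp only [hlin]
  exact H _ _

end PL

/-! ## §2 Functional Anderson: a translate of an even log-concave function loses weight against an even log-concave density -/

section Anderson

variable {ι : Type*} [Fintype ι]

/-- `ℝ≥0∞` bookkeeping: `a·b ≤ c²` gives `a^{1∕2}·b^{1∕2} ≤ c`. [folklore] -/
theorem rpow_half_mul_rpow_half_le {a b c : ℝ≥0∞} (h : a * b ≤ c ^ 2) :
    a ^ (1 / 2 : ℝ) * b ^ (1 / 2 : ℝ) ≤ c := by
  rw [← ENNReal.mul_rpow_of_nonneg _ _ (by norm_num : (0 : ℝ) ≤ 1 / 2)]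
  calc (a * b) ^ (1 / 2 : ℝ) ≤ (c ^ 2) ^ (1 / 2 : ℝ) := ENNReal.rpow_le_rpow h (by norm_num)
    _ = c := by
        rw [← ENNReal.rpow_natCast, ← ENNReal.rpow_mul]
        norm_num

omit [Fintype ι] in
/-- An even, midpoint-log-concave function is maximal at the origin: `F x ≤ F 0`. [folklore] -/
theorem le_apply_zero_of_even_logConcave {F : (ι → ℝ) → ℝ≥0∞} (hFe : ∀ x, F (-x) = F x)
    (hFlc : ∀ x y, F x * F y ≤ F ((2 : ℝ)⁻¹ • (x + y)) ^ 2) (x : ι → ℝ) : F x ≤ F 0 := by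
  have h := hFlc x (-x)
  rw [add_neg_cancel, smul_zero, hFe, ← pow_two] at h
  exact (ENNReal.pow_le_pow_left_iff two_ne_zero).1 h

/-- **FUNCTIONAL ANDERSON INEQUALITY** (T. W. Anderson 1955, functional form; Prékopa–Leindler at `s = ½`).  Let `F, ρ : ℝ^ι → [0,∞]`
be measurable, EVEN, and MIDPOINT-LOG-CONCAVE (`F x · F y ≤ F((x+y)∕2)²`, likewise `ρ`).  Then every translate of `F` has at most
the weight of `F` itself against `ρ`: `∫ F(z + w) ρ(z) dz ≤ ∫ F(z) ρ(z) dz`.  (With `ρ` a centred Gaussian density and `F = 𝟙_K`,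
`K` symmetric convex, this is Anderson's `P(X + w ∈ K) ≤ P(X ∈ K)`.) [folklore] -/
theorem lintegral_shift_mul_le {F ρ : (ι → ℝ) → ℝ≥0∞} (hFm : Measurable F) (hρm : Measurable ρ)
    (hFe : ∀ x, F (-x) = F x) (hρe : ∀ x, ρ (-x) = ρ x)
    (hFlc : ∀ x y, F x * F y ≤ F ((2 : ℝ)⁻¹ • (x + y)) ^ 2) (hρlc : ∀ x y, ρ x * ρ y ≤ ρ ((2 : ℝ)⁻¹ • (x + y)) ^ 2)
    (w : ι → ℝ) :
    ∫⁻ z, F (z + w) * ρ z ≤ ∫⁻ z, F z * ρ z := by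
  have hfm : Measurable fun z => F (z + w) * ρ z := (hFm.comp (measurable_id.add_const w)).mul hρm
  have hgm : Measurable fun z => F (z - w) * ρ z := (hFm.comp (measurable_id.sub_const w)).mul hρm
  have key := prekopaLeindler_fintype (s := 1 / 2) (by norm_num) (by norm_num) (f := fun z => F (z + w) * ρ z)
    (g := fun z => F (z - w) * ρ z) (h := fun z => F z * ρ z) hfm hgm (hFm.mul hρm) (fun x y => by
      -- `(F(x+w)ρ(x))^{1/2} (F(y−w)ρ(y))^{1/2} ≤ F((x+y)/2) ρ((x+y)/2)`
      have hmid : ((1 : ℝ) - 1 / 2) • x + (1 / 2 : ℝ) • y = (2 : ℝ)⁻¹ • (x + y) := by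
        rw [smul_add]; norm_num
      rw [show ((1 : ℝ) - 1 / 2) = 1 / 2 by norm_num] at hmid ⊢
      rw [hmid]
      refine rpow_half_mul_rpow_half_le ?_
      have hF := hFlc (x + w) (y - w)
      rw [show x + w + (y - w) = x + y by abel] at hF
      calc F (x + w) * ρ x * (F (y - w) * ρ y) = (F (x + w) * F (y - w)) * (ρ x * ρ y) := by ring
        _ ≤ F ((2 : ℝ)⁻¹ • (x + y)) ^ 2 * ρ ((2 : ℝ)⁻¹ • (x + y)) ^ 2 := mul_le_mul' hF (hρlc x y)
        _ = (F ((2 : ℝ)⁻¹ • (x + y)) * ρ ((2 : ℝ)⁻¹ • (x + y))) ^ 2 := by rw [mul_pow])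
  -- `∫ F(z − w)ρ(z) = ∫ F(z + w)ρ(z)` by `z ↦ −z` and evenness
  have hgf : ∫⁻ z, F (z - w) * ρ z = ∫⁻ z, F (z + w) * ρ z := by
    calc ∫⁻ z, F (z - w) * ρ z = ∫⁻ z, F (-z - w) * ρ (-z) := (lintegral_neg_eq_self _).symm
      _ = ∫⁻ z, F (z + w) * ρ z := by
          refine lintegral_congr fun z => ?_
          rw [show -z - w = -(z + w) by abel, hFe, hρe]
  rw [hgf, ← ENNReal.rpow_add_of_nonneg _ _ (by norm_num) (by norm_num),
    show ((1 : ℝ) - 1 / 2 + 1 / 2) = 1 by norm_num, ENNReal.rpow_one] at key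
  exact key

end Anderson

/-! ## §3 The Gaussian mixture identity: a wider centred Gaussian is a Gaussian average of translates of the narrow one -/

section Mixture

/-- **ONE COORDINATE.**  For `0 < a ≤ 1`: `∫ e^{−(t−w)²} dN(0, (1−a)∕(2a))(w) = √a · e^{−a t²}` — Mathlib's `gaussianReal` with variance
`((1−a)∕(2a)).toNNReal`, which is the Dirac mass at `0` when `a = 1`. (Complete the square; `integral_gaussian`.) [folklore] -/
theorem integral_exp_neg_sq_sub_gaussianReal {a : ℝ} (ha0 : 0 < a) (ha1 : a ≤ 1) (t : ℝ) :
    ∫ w, exp (-(t - w) ^ 2) ∂(gaussianReal 0 ((1 - a) / (2 * a)).toNNReal) = √a * exp (-(a * t ^ 2)) := by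
  rcases ha1.eq_or_lt with rfl | ha1'
  · simp only [sub_self, zero_div, Real.toNNReal_zero, gaussianReal_zero_var, Real.sqrt_one, one_mul]
    rw [integral_dirac]
    ring_nf
  · set c : ℝ≥0 := ((1 - a) / (2 * a)).toNNReal with hc_def
    have hcpos : (0 : ℝ) < (1 - a) / (2 * a) := div_pos (by linarith) (by linarith)
    have hc : (c : ℝ) = (1 - a) / (2 * a) := Real.coe_toNNReal _ hcpos.le
    have hc0 : c ≠ 0 := by
      intro h
      have : ((c : ℝ≥0) : ℝ) = 0 := by rw [h]; rfl
      rw [hc] at this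
      exact hcpos.ne' this
    rw [integral_gaussianReal_eq_integral_smul hc0]
    simp only [gaussianPDFReal, smul_eq_mul, sub_zero]
    have h1a : 0 < 1 - a := by linarith
    -- complete the square: `−w²/(2c) − (t−w)² = −a t² − (1−a)⁻¹ (w − t(1−a))²`
    have hsq : ∀ w : ℝ, exp (-w ^ 2 / (2 * c)) * exp (-(t - w) ^ 2) =
        exp (-(a * t ^ 2)) * exp (-(1 - a)⁻¹ * (w - t * (1 - a)) ^ 2) := by
      intro w
      rw [← exp_add, ← exp_add]
      congr 1
      rw [hc]
      field_simp
      ring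
    have hexp : ∀ w : ℝ, (√(2 * π * c))⁻¹ * exp (-w ^ 2 / (2 * c)) * exp (-(t - w) ^ 2) =
        ((√(2 * π * c))⁻¹ * exp (-(a * t ^ 2))) * exp (-(1 - a)⁻¹ * (w - t * (1 - a)) ^ 2) := by
      intro w
      calc (√(2 * π * c))⁻¹ * exp (-w ^ 2 / (2 * c)) * exp (-(t - w) ^ 2)
          = (√(2 * π * c))⁻¹ * (exp (-w ^ 2 / (2 * c)) * exp (-(t - w) ^ 2)) := by ring
        _ = (√(2 * π * c))⁻¹ * (exp (-(a * t ^ 2)) * exp (-(1 - a)⁻¹ * (w - t * (1 - a)) ^ 2)) := by rw [hsq]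
        _ = ((√(2 * π * c))⁻¹ * exp (-(a * t ^ 2))) * exp (-(1 - a)⁻¹ * (w - t * (1 - a)) ^ 2) := by ring
    simp_rw [hexp]
    rw [integral_const_mul, integral_sub_right_eq_self (fun w => exp (-(1 - a)⁻¹ * w ^ 2)) (t * (1 - a)),
      integral_gaussian]
    -- constants: `(√(2πc))⁻¹ · √(π/(1−a)⁻¹) = √a`
    have hconst : (√(2 * π * c))⁻¹ * √(π / (1 - a)⁻¹) = √a := by
      rw [← Real.sqrt_inv, ← Real.sqrt_mul (inv_nonneg.2 (by positivity))]
      congr 1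
      rw [hc]
      field_simp
    calc (√(2 * π * ↑c))⁻¹ * exp (-(a * t ^ 2)) * √(π / (1 - a)⁻¹)
        = ((√(2 * π * ↑c))⁻¹ * √(π / (1 - a)⁻¹)) * exp (-(a * t ^ 2)) := by ring
      _ = √a * exp (-(a * t ^ 2)) := by rw [hconst]

variable {ι : Type*} [Fintype ι]

/-- **ALL COORDINATES** (product of the one-coordinate identities, Fubini on the product measure): with
`ν = ⊗ᵢ N(0, (1−aᵢ)∕(2aᵢ))` on `ι → ℝ`, `∫ e^{−Σᵢ(yᵢ−wᵢ)²} dν(w) = (Πᵢ √aᵢ) · e^{−Σᵢ aᵢyᵢ²}`. [folklore] -/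
theorem integral_exp_neg_sum_sq_sub_pi (a : ι → ℝ) (ha0 : ∀ i, 0 < a i) (ha1 : ∀ i, a i ≤ 1) (y : ι → ℝ) :
    ∫ w, exp (-∑ i, (y i - w i) ^ 2) ∂(Measure.pi fun i => gaussianReal 0 ((1 - a i) / (2 * a i)).toNNReal) =
      (∏ i, √(a i)) * exp (-∑ i, a i * y i ^ 2) := by
  have h : ∀ w : ι → ℝ, exp (-∑ i, (y i - w i) ^ 2) = ∏ i, exp (-(y i - w i) ^ 2) := fun w => by
    rw [← Finset.sum_neg_distrib, exp_sum]
  simp_rw [h]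
  rw [integral_fintype_prod_eq_prod (fun i (w : ℝ) => exp (-(y i - w) ^ 2))]
  simp_rw [integral_exp_neg_sq_sub_gaussianReal (ha0 _) (ha1 _)]
  rw [Finset.prod_mul_distrib, ← exp_sum, ← Finset.sum_neg_distrib]

/-- The same identity for the `ℝ≥0∞`-valued weights used below. [folklore] -/
theorem lintegral_exp_neg_sum_sq_sub_pi (a : ι → ℝ) (ha0 : ∀ i, 0 < a i) (ha1 : ∀ i, a i ≤ 1) (y : ι → ℝ) :
    ∫⁻ w, ENNReal.ofReal (exp (-∑ i, (y i - w i) ^ 2)) ∂(Measure.pi fun i => gaussianReal 0 ((1 - a i) / (2 * a i)).toNNReal) =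
      ENNReal.ofReal ((∏ i, √(a i)) * exp (-∑ i, a i * y i ^ 2)) := by
  rw [← integral_exp_neg_sum_sq_sub_pi a ha0 ha1 y, ofReal_integral_eq_lintegral_ofReal]
  · have hcont : Continuous fun w : ι → ℝ => exp (-∑ i, (y i - w i) ^ 2) := by fun_prop
    refine Integrable.mono' (integrable_const (1 : ℝ)) hcont.aestronglyMeasurable (Filter.Eventually.of_forall fun w => ?_)
    rw [Real.norm_eq_abs, abs_of_nonneg (exp_pos _).le, exp_le_one_iff, neg_nonpos]
    exact Finset.sum_nonneg fun i _ => sq_nonneg _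
  · exact Filter.Eventually.of_forall fun w => (exp_pos _).le

end Mixture

/-! ## §4 The comparison: a wider centred Gaussian gives less weight to an even log-concave function -/

section Comparison

variable {ι : Type*} [Fintype ι]

/-- **THE MIXTURE REPRESENTATION OF THE WIDE GAUSSIAN WEIGHT** (Tonelli + translation invariance of Lebesgue measure): for every
measurable `G : ℝ^ι → [0,∞]`, `(Πᵢ√aᵢ) · ∫ G(y) e^{−Σaᵢyᵢ²} dy = ∫ (∫ G(z + w) e^{−|z|²} dz) dν(w)` with the mixing law
`ν = ⊗ᵢ N(0, (1−aᵢ)∕(2aᵢ))` of §3. [folklore] -/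
theorem lintegral_mixture_eq (a : ι → ℝ) (ha0 : ∀ i, 0 < a i) (ha1 : ∀ i, a i ≤ 1) {G : (ι → ℝ) → ℝ≥0∞}
    (hGm : Measurable G) :
    ENNReal.ofReal (∏ i, √(a i)) * ∫⁻ y, G y * ENNReal.ofReal (exp (-∑ i, a i * y i ^ 2)) =
      ∫⁻ w, (∫⁻ z, G (z + w) * ENNReal.ofReal (exp (-∑ i, z i ^ 2)))
        ∂(Measure.pi fun i => gaussianReal 0 ((1 - a i) / (2 * a i)).toNNReal) := by
  set ν : Measure (ι → ℝ) := Measure.pi fun i => gaussianReal 0 ((1 - a i) / (2 * a i)).toNNReal with hν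
  have hκ : 0 ≤ ∏ i, √(a i) := Finset.prod_nonneg fun i _ => Real.sqrt_nonneg _
  have hker : Measurable fun p : (ι → ℝ) × (ι → ℝ) => G p.1 * ENNReal.ofReal (exp (-∑ i, (p.1 i - p.2 i) ^ 2)) := by
    refine (hGm.comp measurable_fst).mul (Measurable.ennreal_ofReal ?_)
    exact (Continuous.measurable (by fun_prop))
  -- Step 1: the constant inside, then the wide weight as a `ν`-average of translated narrow weights
  have h1 : ENNReal.ofReal (∏ i, √(a i)) * ∫⁻ y, G y * ENNReal.ofReal (exp (-∑ i, a i * y i ^ 2)) =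
      ∫⁻ y, G y * ∫⁻ w, ENNReal.ofReal (exp (-∑ i, (y i - w i) ^ 2)) ∂ν := by
    rw [← lintegral_const_mul' _ _ ENNReal.ofReal_ne_top]
    refine lintegral_congr fun y => ?_
    rw [hν, lintegral_exp_neg_sum_sq_sub_pi a ha0 ha1 y, ENNReal.ofReal_mul hκ]
    ring
  -- Step 2: Tonelli
  have h2 : ∫⁻ y, G y * ∫⁻ w, ENNReal.ofReal (exp (-∑ i, (y i - w i) ^ 2)) ∂ν =
      ∫⁻ w, ∫⁻ y, G y * ENNReal.ofReal (exp (-∑ i, (y i - w i) ^ 2)) ∂volume ∂ν := by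
    have e : ∀ y, G y * ∫⁻ w, ENNReal.ofReal (exp (-∑ i, (y i - w i) ^ 2)) ∂ν =
        ∫⁻ w, G y * ENNReal.ofReal (exp (-∑ i, (y i - w i) ^ 2)) ∂ν := fun y => by
      rw [lintegral_const_mul]
      exact Measurable.ennreal_ofReal (Continuous.measurable (by fun_prop))
    simp_rw [e]
    exact lintegral_lintegral_swap hker.aemeasurable
  -- Step 3: translation invariance `y = w + z`
  have h3 : ∀ w : ι → ℝ, ∫⁻ y, G y * ENNReal.ofReal (exp (-∑ i, (y i - w i) ^ 2)) =
      ∫⁻ z, G (z + w) * ENNReal.ofReal (exp (-∑ i, z i ^ 2)) := by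
    intro w
    rw [← lintegral_add_right_eq_self (fun y => G y * ENNReal.ofReal (exp (-∑ i, (y i - w i) ^ 2))) w]
    refine lintegral_congr fun z => ?_
    simp only [Pi.add_apply, add_sub_cancel_right]
  rw [h1, h2]
  exact lintegral_congr fun w => h3 w

/-- The narrow Gaussian weight `e^{−|z|²}` is measurable, even and midpoint-log-concave. [folklore] -/
theorem gaussWeight_evenLogConcave :
    Measurable (fun z : ι → ℝ => ENNReal.ofReal (exp (-∑ i, z i ^ 2))) ∧
      (∀ z : ι → ℝ, ENNReal.ofReal (exp (-∑ i, (-z) i ^ 2)) = ENNReal.ofReal (exp (-∑ i, z i ^ 2))) ∧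
      (∀ x y : ι → ℝ, ENNReal.ofReal (exp (-∑ i, x i ^ 2)) * ENNReal.ofReal (exp (-∑ i, y i ^ 2)) ≤
        ENNReal.ofReal (exp (-∑ i, ((2 : ℝ)⁻¹ • (x + y)) i ^ 2)) ^ 2) := by
  refine ⟨Measurable.ennreal_ofReal (Continuous.measurable (by fun_prop)), fun z => by simp, fun x y => ?_⟩
  rw [← ENNReal.ofReal_mul (exp_pos _).le, ← ENNReal.ofReal_pow (exp_pos _).le, ← exp_add, ← exp_nat_mul]
  refine ENNReal.ofReal_le_ofReal (exp_le_exp.2 ?_)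
  simp only [Pi.smul_apply, Pi.add_apply, smul_eq_mul, Nat.cast_ofNat]
  have hterm : ∀ i, 2 * ((2 : ℝ)⁻¹ * (x i + y i)) ^ 2 ≤ x i ^ 2 + y i ^ 2 := fun i => by
    nlinarith [sq_nonneg (x i - y i)]
  have hsum : ∑ i, 2 * ((2 : ℝ)⁻¹ * (x i + y i)) ^ 2 ≤ ∑ i, (x i ^ 2 + y i ^ 2) :=
    Finset.sum_le_sum fun i _ => hterm i
  rw [Finset.sum_add_distrib, ← Finset.mul_sum] at hsum
  linarith

/-- **THE COMPARISON** (Anderson 1955, Gaussian corollary, functional form).  Let `F : ℝ^ι → [0,∞]` be measurable, EVEN and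
MIDPOINT-LOG-CONCAVE, and let `0 < aᵢ ≤ 1`.  Then the WIDER centred Gaussian weight `e^{−Σaᵢyᵢ²}` gives `F` at most the normalised
weight that `e^{−|y|²}` gives it:
  `(∫ F·e^{−Σaᵢyᵢ²}) · (∫ e^{−|y|²}) ≤ (∫ F·e^{−|y|²}) · (∫ e^{−Σaᵢyᵢ²})`.
Proof: the wide weight is a Gaussian average of translates of the narrow one (§3–§4), and each translate of `F` loses weight
(§2, functional Anderson).  No smallness, no dimension dependence, no rank condition. [folklore] -/
theorem lintegral_mul_wide_le (a : ι → ℝ) (ha0 : ∀ i, 0 < a i) (ha1 : ∀ i, a i ≤ 1) {F : (ι → ℝ) → ℝ≥0∞}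
    (hFm : Measurable F) (hFe : ∀ x, F (-x) = F x) (hFlc : ∀ x y, F x * F y ≤ F ((2 : ℝ)⁻¹ • (x + y)) ^ 2) :
    (∫⁻ y, F y * ENNReal.ofReal (exp (-∑ i, a i * y i ^ 2))) * (∫⁻ y : ι → ℝ, ENNReal.ofReal (exp (-∑ i, y i ^ 2))) ≤
      (∫⁻ y, F y * ENNReal.ofReal (exp (-∑ i, y i ^ 2))) *
        (∫⁻ y : ι → ℝ, ENNReal.ofReal (exp (-∑ i, a i * y i ^ 2))) := by
  set ν : Measure (ι → ℝ) := Measure.pi fun i => gaussianReal 0 ((1 - a i) / (2 * a i)).toNNReal with hν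
  set κ : ℝ≥0∞ := ENNReal.ofReal (∏ i, √(a i)) with hκ
  obtain ⟨hρm, hρe, hρlc⟩ := gaussWeight_evenLogConcave (ι := ι)
  -- the `F`-weighted wide integral, through the mixture and functional Anderson
  have hF : κ * ∫⁻ y, F y * ENNReal.ofReal (exp (-∑ i, a i * y i ^ 2)) ≤
      ∫⁻ y, F y * ENNReal.ofReal (exp (-∑ i, y i ^ 2)) := by
    rw [hκ, lintegral_mixture_eq a ha0 ha1 hFm]
    calc ∫⁻ w, (∫⁻ z, F (z + w) * ENNReal.ofReal (exp (-∑ i, z i ^ 2))) ∂ν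
        ≤ ∫⁻ _w, (∫⁻ z, F z * ENNReal.ofReal (exp (-∑ i, z i ^ 2))) ∂ν :=
          lintegral_mono fun w => lintegral_shift_mul_le hFm hρm hFe hρe hFlc hρlc w
      _ = ∫⁻ z, F z * ENNReal.ofReal (exp (-∑ i, z i ^ 2)) := by
          rw [lintegral_const, measure_univ, mul_one]
  -- the unweighted wide integral: the same computation is an identity
  have h1 : κ * ∫⁻ y : ι → ℝ, ENNReal.ofReal (exp (-∑ i, a i * y i ^ 2)) =
      ∫⁻ y : ι → ℝ, ENNReal.ofReal (exp (-∑ i, y i ^ 2)) := by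
    have h := lintegral_mixture_eq a ha0 ha1 (G := fun _ => (1 : ℝ≥0∞)) measurable_const
    simp only [one_mul] at h
    rw [hκ, h, lintegral_const, measure_univ, mul_one]
  calc (∫⁻ y, F y * ENNReal.ofReal (exp (-∑ i, a i * y i ^ 2))) * ∫⁻ y : ι → ℝ, ENNReal.ofReal (exp (-∑ i, y i ^ 2))
      = (κ * ∫⁻ y, F y * ENNReal.ofReal (exp (-∑ i, a i * y i ^ 2))) *
          ∫⁻ y : ι → ℝ, ENNReal.ofReal (exp (-∑ i, a i * y i ^ 2)) := by rw [← h1]; ring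
    _ ≤ (∫⁻ y, F y * ENNReal.ofReal (exp (-∑ i, y i ^ 2))) * ∫⁻ y : ι → ℝ, ENNReal.ofReal (exp (-∑ i, a i * y i ^ 2)) :=
        mul_le_mul' hF le_rfl

end Comparison

end Summit.QuantumFields.BalabanUV.T4Continuum.NE7b.AndersonGaussianComparison
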